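import Mathlib
import HarnessLib
import Literature.MathematicalPhysics.KineticTheory.HardSphereEulerProofs
import Literature.Analysis.FluidPDE.HardSphereCollisionRecord
import Summits.AtomisticToContinuum.HydrodynamicLimit.Theorems.OneFlightGossipEngineKineticCurrentsWindowLDUniformKickFiltration
import Summits.AtomisticToContinuum.HydrodynamicLimit.Theorems.OneFlightGossipEngineKineticCurrentsWindowLDUniformLedgerAssemblyStatics
import Summits.AtomisticToContinuum.HydrodynamicLimit.Theorems.OneFlightGossipEngineKineticCurrentsWindowLDUniformLedgerAssemblyDuality
import Summits.AtomisticToContinuum.HydrodynamicLimit.Theorems.OneFlightGossipEngineKineticCurrentsWindowLDUniformFibreExpMoment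

/-!
# Crux `KineticCurrentsWindowLDUniform` (stmt-AtomisticToContinuum-14662), line `gossip-forecast-ledger`,
# stub `stub_forecastIncrementExpIntegrable` (S4b): forecast increments are exponentially integrable

Under the local Gibbs law `μ = λ_N = localGibbsLaw σ a u₀ θ₀ N Φ` (`σ ≤ 1/2`, a probability measure
carried by the good set of the flow), let `X = X_S` be the window functional of a half `S` for a
continuous one-body observable `F` with `|F| ≤ C(1+‖v‖²)`, `ℱ` the group kick filtration of `S`
(Borel: `stub_kickFiltration`) and `f_j = μ[X | ℱ j]` the forecast martingale.  We prove
`e^{α(f_{k+1} − f_k)} ∈ L¹(μ)` for every `k` as soon as `α · 16 · max(C,1) · sup θ₀ ≤ 1`: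

* `ForecastIncrement.ae_abs_condExp_le_affine` — an a.e. affine energy bound `|X| ≤ A + B·E`
  passes to forecasts, `|μ[X|m]| ≤ A + B·μ[E|m]` a.e. (`condExp_mono`, linearity);
* `ForecastIncrement.integrable_exp_mul_condExp_sub` — hence
  `e^{α(f₁−f₂)} ≤ e^{2αA}(e^{2αB μ[E|m₁]} + e^{2αB μ[E|m₂]})/2` (AM–GM) is integrable once
  `e^{2αB E}` is (conditional Jensen for `exp`, `LedgerAssembly.integrable_exp_mul_condExp`);
* `ForecastIncrement.integrable_exp_mul_energy` — the static Gaussian moment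
  `e^{s Σᵢ‖vᵢ‖²} ∈ L¹(λ_N)` for `8 s θ₀ ≤ 1` (fibre bound
  `LedgerAssembly.lintegral_exp_mul_norm_sq_localMaxwellian_le` and the product disintegration
  `KineticCurrentsWindowLDUniformSketch.stub_fibreExpMoment`);
* the registered statement: `|X_S| ≤ C'|S| + C' Σᵢ‖vᵢ‖²` on the good set (`C' = max C 1`,
  `LedgerAssembly.abs_windowSum_le`, energy conservation) with `s = 2αC'`.

References: H. Spohn, *Large Scale Dynamics of Interacting Particles* (1991), Part I §2.3;
C. Kipnis, C. Landim, *Scaling Limits of Interacting Particle Systems* (1999), App. 1 §8.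
-/

noncomputable section

open MeasureTheory Set Filter InformationTheory
open scoped ENNReal Topology Classical ProbabilityTheory

namespace Summit.AtomisticToContinuum.HydrodynamicLimit.Theorems.KineticCurrentsWindowLDUniformGossip

open Literature.Analysis.FluidPDE (HardSphereFlow Config localMaxwellian collisionTimesOf nthTimeAfter)
open Literature.MathematicalPhysics.KineticTheory (T3 V3 hsDiameter localGibbsLaw localGibbsMeasure
  isProbabilityMeasure_localGibbsLaw localGibbsLaw_eq localGibbsMeasure_absolutelyContinuous)
open Summit.AtomisticToContinuum.HydrodynamicLimit.Theorems.KineticCurrentsWindowLDUniformSketch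
  (stub_fibreExpMoment)

namespace ForecastIncrement

/-! ### Elementary and generic steps -/

/-- AM–GM form of the increment bound: if `|f₁| ≤ A + B G₁` and `|f₂| ≤ A + B G₂` then
`e^{α(f₁ - f₂)} ≤ e^{2αA}/2 · (e^{2αB G₁} + e^{2αB G₂})` for `α ≥ 0`. [folklore] -/
theorem exp_mul_sub_le {α A B f₁ f₂ G₁ G₂ : ℝ} (hα : 0 ≤ α) (h₁ : |f₁| ≤ A + B * G₁)
    (h₂ : |f₂| ≤ A + B * G₂) :
    Real.exp (α * (f₁ - f₂)) ≤
      Real.exp (2 * α * A) / 2 * (Real.exp (2 * α * B * G₁) + Real.exp (2 * α * B * G₂)) := by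
  have hle : α * (f₁ - f₂) ≤ 2 * α * A + (α * B * G₁ + α * B * G₂) := by
    have h : f₁ - f₂ ≤ (A + B * G₁) + (A + B * G₂) := by
      linarith [le_abs_self f₁, neg_abs_le f₂]
    calc α * (f₁ - f₂) ≤ α * ((A + B * G₁) + (A + B * G₂)) := mul_le_mul_of_nonneg_left h hα
      _ = _ := by ring
  have hsq : ∀ G : ℝ, Real.exp (α * B * G) ^ 2 = Real.exp (2 * α * B * G) := fun G => by
    rw [sq, ← Real.exp_add]
    congr 1
    ring
  have hamgm : Real.exp (α * B * G₁) * Real.exp (α * B * G₂) ≤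
      (Real.exp (2 * α * B * G₁) + Real.exp (2 * α * B * G₂)) / 2 := by
    rw [← hsq G₁, ← hsq G₂]
    linarith [two_mul_le_add_sq (Real.exp (α * B * G₁)) (Real.exp (α * B * G₂))]
  calc Real.exp (α * (f₁ - f₂)) ≤ Real.exp (2 * α * A + (α * B * G₁ + α * B * G₂)) :=
        Real.exp_le_exp.2 hle
    _ = Real.exp (2 * α * A) * (Real.exp (α * B * G₁) * Real.exp (α * B * G₂)) := by
        rw [Real.exp_add, Real.exp_add]
    _ ≤ Real.exp (2 * α * A) * ((Real.exp (2 * α * B * G₁) + Real.exp (2 * α * B * G₂)) / 2) :=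
        mul_le_mul_of_nonneg_left hamgm (Real.exp_pos _).le
    _ = _ := by ring

section Generic

variable {Ω : Type*} {m mΩ : MeasurableSpace Ω} {P : Measure Ω} [IsFiniteMeasure P]

/-- A two-sided affine bound passes to the forecast: if `|X| ≤ A + B·E` a.e. then
`|P[X|m]| ≤ A + B·P[E|m]` a.e. (`|P[X|m]| ≤ P[|X| |m]`, `condExp_mono`, linearity). [folklore] -/
theorem ae_abs_condExp_le_affine (hm : m ≤ mΩ) {X E : Ω → ℝ} (hX : Integrable X P)
    (hE : Integrable E P) {A B : ℝ} (hXE : ∀ᵐ ω ∂P, |X ω| ≤ A + B * E ω) :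
    ∀ᵐ ω ∂P, |(P[X|m]) ω| ≤ A + B * (P[E|m]) ω := by
  have h1 : ∀ᵐ ω ∂P, |(P[X|m]) ω| ≤ (P[fun ω => |X ω| | m]) ω :=
    (abs_condExp_ae_le_condExp_abs (m := m) (μ := P) X).mono fun ω hω => hω
  have hB : Integrable ((fun _ => A) + B • E) P := (integrable_const A).add (hE.smul B)
  have h2 : P[fun ω => |X ω| | m] ≤ᵐ[P] P[(fun _ => A) + B • E | m] :=
    condExp_mono hX.abs hB (hXE.mono fun ω hω => by
      simpa only [Pi.add_apply, Pi.smul_apply, smul_eq_mul] using hω)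
  have h3 : P[(fun _ => A) + B • E | m] =ᵐ[P] fun ω => A + B * (P[E|m]) ω := by
    filter_upwards [condExp_add (integrable_const A) (hE.smul B) m, condExp_smul B E m]
      with ω hadd hsmul
    rw [hadd, Pi.add_apply, condExp_const hm A, hsmul, Pi.smul_apply, smul_eq_mul]
  filter_upwards [h1, h2, h3] with ω h1 h2 h3
  exact h1.trans (h2.trans_eq h3)

/-- **Exponential integrability of a forecast increment from a static moment.** If
`|X| ≤ A + B·E` a.e., `α ≥ 0` and `e^{2αB E} ∈ L¹(P)`, then for any two sub-σ-algebras `m₁, m₂`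
the increment of the forecasts satisfies `e^{α(P[X|m₁] − P[X|m₂])} ∈ L¹(P)`: by
`ae_abs_condExp_le_affine` and AM–GM it is dominated by
`e^{2αA}(e^{2αB P[E|m₁]} + e^{2αB P[E|m₂]})/2`, integrable by conditional Jensen for `exp`
(`LedgerAssembly.integrable_exp_mul_condExp`). [folklore] -/
theorem integrable_exp_mul_condExp_sub {m₁ m₂ : MeasurableSpace Ω} (hm₁ : m₁ ≤ mΩ)
    (hm₂ : m₂ ≤ mΩ) {X E : Ω → ℝ} (hX : Integrable X P) (hE : Integrable E P) {A B : ℝ}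
    (hXE : ∀ᵐ ω ∂P, |X ω| ≤ A + B * E ω) {α : ℝ} (hα : 0 ≤ α)
    (hexp : Integrable (fun ω => Real.exp (2 * α * B * E ω)) P) :
    Integrable (fun ω => Real.exp (α * ((P[X|m₁]) ω - (P[X|m₂]) ω))) P := by
  have hb₁ := ae_abs_condExp_le_affine hm₁ hX hE hXE
  have hb₂ := ae_abs_condExp_le_affine hm₂ hX hE hXE
  have hI₁ := (LedgerAssembly.integrable_exp_mul_condExp hm₁ hE (2 * α * B) hexp).1
  have hI₂ := (LedgerAssembly.integrable_exp_mul_condExp hm₂ hE (2 * α * B) hexp).1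
  have hsm₁ : StronglyMeasurable[mΩ] (P[X|m₁]) := stronglyMeasurable_condExp.mono hm₁
  have hsm₂ : StronglyMeasurable[mΩ] (P[X|m₂]) := stronglyMeasurable_condExp.mono hm₂
  have hmeas : AEStronglyMeasurable[mΩ] (fun ω => Real.exp (α * ((P[X|m₁]) ω - (P[X|m₂]) ω))) P :=
    (Real.continuous_exp.comp_stronglyMeasurable ((hsm₁.sub hsm₂).const_mul α)).aestronglyMeasurable
  refine ((hI₁.add hI₂).const_mul (Real.exp (2 * α * A) / 2)).mono' hmeas ?_
  filter_upwards [hb₁, hb₂] with ω h₁ h₂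
  rw [Real.norm_eq_abs, abs_of_pos (Real.exp_pos _), Pi.add_apply]
  exact exp_mul_sub_le hα h₁ h₂

end Generic

/-! ### The static Gaussian moment of the kinetic energy under the local Gibbs law -/

/-- **Static exponential moment of the kinetic energy.** For continuous profiles, `0 < σ ≤ 1/2`,
`0 ≤ s` with `8 s θ₀ ≤ 1` pointwise, `z ↦ e^{s Σᵢ ‖vᵢ‖²}` is integrable for the local Gibbs law
`λ_N` (for every `N` and every flow): the integrand is the product of the one-body factors
`e^{s‖v‖²}`, whose local-Maxwellian fibre integrals are at most `2^{3/2} e^{2 s sup‖u₀‖²}`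
(`LedgerAssembly.lintegral_exp_mul_norm_sq_localMaxwellian_le`), so
`KineticCurrentsWindowLDUniformSketch.stub_fibreExpMoment` bounds the `∫⁻` by a finite power. [folklore] -/
theorem integrable_exp_mul_energy {a θ₀ : T3 → ℝ} {u₀ : T3 → V3} (ha : Continuous a)
    (hθ : Continuous θ₀) (hu : Continuous u₀) (ha0 : ∀ x, 0 < a x) (hθ0 : ∀ x, 0 < θ₀ x) {σ : ℝ}
    (hσ : 0 < σ) (hσ2 : σ ≤ 1 / 2) {s : ℝ} (hs : 0 ≤ s) (hsθ : ∀ x, 8 * s * θ₀ x ≤ 1) (N : ℕ)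
    (Φ : HardSphereFlow (Literature.Analysis.FluidPDE.Torus.geometry (Fin 3)) (hsDiameter σ N) (N + 1)) :
    Integrable (fun z : Config (N + 1) (Fin 3) T3 => Real.exp (s * ∑ i, ‖(z i).2‖ ^ 2))
      (localGibbsLaw σ a u₀ θ₀ N Φ) := by
  -- a bound on the drift
  obtain ⟨U, hU⟩ := (isCompact_univ (X := T3)).exists_bound_of_continuousOn hu.continuousOn
  have hU' : ∀ x, ‖u₀ x‖ ≤ U := fun x => hU x (mem_univ x)
  -- the one-body factor and its fibre bound
  set g : T3 × V3 → ℝ≥0∞ := fun y => ENNReal.ofReal (Real.exp (s * ‖y.2‖ ^ 2)) with hgdef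
  have hgm : Measurable g := by
    rw [hgdef]
    exact (Real.measurable_exp.comp (measurable_const.mul (measurable_snd.norm.pow_const 2))).ennreal_ofReal
  set K : ℝ≥0∞ := ENNReal.ofReal ((2 : ℝ) ^ ((3 : ℝ) / 2) * Real.exp (2 * s * U ^ 2)) with hKdef
  have hfib : ∀ x : T3, ∫⁻ v, g (x, v) * ENNReal.ofReal (localMaxwellian 1 (θ₀ x) (u₀ x) v) ≤ K := by
    intro x
    refine (LedgerAssembly.lintegral_exp_mul_norm_sq_localMaxwellian_le (hθ0 x) hs (hsθ x) (u₀ x)).trans ?_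
    refine ENNReal.ofReal_le_ofReal (mul_le_mul_of_nonneg_left (Real.exp_le_exp.2 ?_) (by positivity))
    exact mul_le_mul_of_nonneg_left (pow_le_pow_left₀ (norm_nonneg _) (hU' x) 2) (by positivity)
  -- the product disintegration
  have hprod : ∫⁻ z, ∏ i, g (z i) ∂(localGibbsLaw σ a u₀ θ₀ N Φ) ≤ K ^ (N + 1) := by
    rw [localGibbsLaw_eq]
    exact stub_fibreExpMoment a θ₀ u₀ ha hθ hu ha0 hθ0 σ hσ hσ2 N g hgm K hfib
  have heq : ∀ z : Config (N + 1) (Fin 3) T3,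
      ENNReal.ofReal (Real.exp (s * ∑ i, ‖(z i).2‖ ^ 2)) = ∏ i, g (z i) := by
    intro z
    rw [hgdef]
    simp only []
    rw [← ENNReal.ofReal_prod_of_nonneg fun i _ => (Real.exp_pos _).le, ← Real.exp_sum,
      Finset.mul_sum]
  have hcont : Continuous fun z : Config (N + 1) (Fin 3) T3 => Real.exp (s * ∑ i, ‖(z i).2‖ ^ 2) := by
    fun_prop
  have hne : ∫⁻ z, ENNReal.ofReal (Real.exp (s * ∑ i, ‖(z i).2‖ ^ 2)) ∂(localGibbsLaw σ a u₀ θ₀ N Φ) ≠ ∞ := by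
    refine ne_top_of_le_ne_top (ENNReal.pow_ne_top ENNReal.ofReal_ne_top : K ^ (N + 1) ≠ ∞) ?_
    calc ∫⁻ z, ENNReal.ofReal (Real.exp (s * ∑ i, ‖(z i).2‖ ^ 2)) ∂(localGibbsLaw σ a u₀ θ₀ N Φ)
        = ∫⁻ z, ∏ i, g (z i) ∂(localGibbsLaw σ a u₀ θ₀ N Φ) := lintegral_congr fun z => heq z
      _ ≤ K ^ (N + 1) := hprod
  exact (lintegral_ofReal_ne_top_iff_integrable hcont.aestronglyMeasurable
    (ae_of_all _ fun _ => (Real.exp_pos _).le)).1 hne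

end ForecastIncrement


/-- S4b — under the local Gibbs law the increments of the forecast martingale of a half's window functional are exponentially integrable at every static order `α ≤ 1/(16·max(C,1)·sup θ₀)` (registered stub `stub_forecastIncrementExpIntegrable` of line `gossip-forecast-ledger`, crux stmt-AtomisticToContinuum-14662). [folklore] -/
theorem stub_forecastIncrementExpIntegrable :
    ∀ (a θ₀ : T3 → ℝ) (u₀ : T3 → V3), Continuous a → Continuous θ₀ → Continuous u₀ →
      (∀ x, 0 < a x) → (∀ x, 0 < θ₀ x) → ∀ σ : ℝ, 0 < σ → σ ≤ 1 / 2 → ∀ N : ℕ,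
      ∀ Φ : HardSphereFlow (Literature.Analysis.FluidPDE.Torus.geometry (Fin 3)) (hsDiameter σ N) (N + 1),
      ∀ (F : T3 × V3 → ℝ), Continuous F → ∀ C : ℝ, (∀ y, |F y| ≤ C * (1 + ‖y.2‖ ^ 2)) →
      ∀ α : ℝ, 0 < α → α * (16 * max C 1 * ⨆ x, θ₀ x) ≤ 1 → ∀ τ : ℝ, 0 < τ →
      ∀ S : Finset (Fin (N + 1)),
      let μ : Measure (Config (N + 1) (Fin 3) T3) := localGibbsLaw σ a u₀ θ₀ N Φ
      let X : Config (N + 1) (Fin 3) T3 → ℝ := fun z => ∑ i ∈ S, (τ * ((N : ℝ) + 1) ^ (-(1 / 3 : ℝ)))⁻¹ * ∫ r in (0 : ℝ)..(τ * ((N : ℝ) + 1) ^ (-(1 / 3 : ℝ))), F ((Φ.flow r z) i)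
      let T : Config (N + 1) (Fin 3) T3 → Set ℝ := fun z =>
        ⋃ i ∈ S, collisionTimesOf (Literature.Analysis.FluidPDE.Torus.geometry (Fin 3)) (hsDiameter σ N) (fun t => Φ.flow t z) i
      let tk : ℕ → Config (N + 1) (Fin 3) T3 → ℝ := fun k z => if z ∈ Φ.good then nthTimeAfter (T z) 0 k else 0
      let ℱ : ℕ → MeasurableSpace (Config (N + 1) (Fin 3) T3) := fun n =>
        MeasurableSpace.comap (fun (z : Config (N + 1) (Fin 3) T3) (i : S) => z i.1) inferInstance ⊔
          ⨆ k < n, MeasurableSpace.comap (fun (z : Config (N + 1) (Fin 3) T3) => (tk k z, fun i : S => Φ.flow (tk k z) z i.1))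
            inferInstance
      ∀ k : ℕ, Integrable (fun z => Real.exp (α * ((μ[X|ℱ (k + 1)]) z - (μ[X|ℱ k]) z))) μ := by
  intro a θ₀ u₀ ha hθ hu ha0 hθ0 σ hσ hσ2 N Φ F hFc C hC α hα hαle τ hτ S μ X T tk ℱ k
  /- (1) the group kick filtration is Borel and `X` is a.e. strongly measurable (S1) -/
  have hKF := stub_kickFiltration σ hσ a θ₀ u₀ N Φ F hFc τ hτ S
  have hle : ∀ n, ℱ n ≤ (inferInstance : MeasurableSpace (Config (N + 1) (Fin 3) T3)) := hKF.1
  have hXm' : AEStronglyMeasurable[⨆ n, ℱ n] X μ := hKF.2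
  have hXm : AEStronglyMeasurable X μ := hXm'.mono (iSup_le hle)
  /- (2) the law: a probability measure carried by the good set -/
  haveI : IsProbabilityMeasure μ := isProbabilityMeasure_localGibbsLaw ha hθ hu ha0 hθ0 hσ2 N Φ
  have hμgood : μ Φ.goodᶜ = 0 := by
    show localGibbsLaw σ a u₀ θ₀ N Φ Φ.goodᶜ = 0
    rw [localGibbsLaw_eq]
    exact localGibbsMeasure_absolutelyContinuous σ a u₀ θ₀ N Φ Φ.measure_compl_good
  have hae : ∀ᵐ z ∂μ, z ∈ Φ.good := mem_ae_iff.2 hμgood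
  /- (3) constants: `C' = max C 1`, the Gaussian parameter `2 α C'` obeys `8 (2αC') θ₀ ≤ 1` -/
  set C' : ℝ := max C 1 with hC'def
  have hC'0 : 0 < C' := lt_of_lt_of_le one_pos (le_max_right _ _)
  have hC' : ∀ y, |F y| ≤ C' * (1 + ‖y.2‖ ^ 2) := fun y =>
    (hC y).trans (mul_le_mul_of_nonneg_right (le_max_left _ _) (by positivity))
  have hs0 : 0 < 2 * α * C' := by positivity
  have hsθ : ∀ x, 8 * (2 * α * C') * θ₀ x ≤ 1 := by
    intro x
    have h1 : θ₀ x ≤ ⨆ y, θ₀ y := le_ciSup (isCompact_range hθ).bddAbove x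
    calc 8 * (2 * α * C') * θ₀ x = 16 * (α * C') * θ₀ x := by ring
      _ ≤ 16 * (α * C') * ⨆ y, θ₀ y := mul_le_mul_of_nonneg_left h1 (by positivity)
      _ = α * (16 * C' * ⨆ y, θ₀ y) := by ring
      _ ≤ 1 := hαle
  /- (4) the kinetic energy: static exponential moment, integrability -/
  set E : Config (N + 1) (Fin 3) T3 → ℝ := fun z => ∑ i, ‖(z i).2‖ ^ 2 with hEdef
  have hE0 : ∀ z, 0 ≤ E z := fun z => Finset.sum_nonneg fun i _ => sq_nonneg _
  have hEc : Continuous E := by rw [hEdef]; fun_prop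
  have hexpE : Integrable (fun z => Real.exp (2 * α * C' * E z)) μ :=
    ForecastIncrement.integrable_exp_mul_energy ha hθ hu ha0 hθ0 hσ hσ2 hs0.le hsθ N Φ
  have hEint : Integrable E μ := by
    refine (hexpE.div_const (2 * α * C')).mono' hEc.aestronglyMeasurable (ae_of_all _ fun z => ?_)
    rw [Real.norm_eq_abs, abs_of_nonneg (hE0 z), le_div_iff₀ hs0]
    nlinarith [Real.add_one_le_exp (2 * α * C' * E z)]
  /- (5) the energy bound on the good set and integrability of `X` -/
  have hw : 0 < τ * ((N : ℝ) + 1) ^ (-(1 / 3 : ℝ)) :=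
    mul_pos hτ (Real.rpow_pos_of_pos (by positivity) _)
  have hXE : ∀ᵐ z ∂μ, |X z| ≤ C' * (S.card : ℝ) + C' * E z := by
    filter_upwards [hae] with z hz
    exact LedgerAssembly.abs_windowSum_le Φ hFc hC'0.le hC' hz S hw
  have hBint : Integrable (fun z => C' * (S.card : ℝ) + C' * E z) μ :=
    (integrable_const _).add (hEint.const_mul C')
  have hXint : Integrable X μ :=
    hBint.mono' hXm (hXE.mono fun z hz => (Real.norm_eq_abs _).trans_le hz)
  /- (6) conclusion: the generic increment lemma -/
  exact ForecastIncrement.integrable_exp_mul_condExp_sub (hle (k + 1)) (hle k) hXint hEint hXE hα.le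
    hexpE

end Summit.AtomisticToContinuum.HydrodynamicLimit.Theorems.KineticCurrentsWindowLDUniformGossip

end
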